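import Summits.QuantumFields.YangMills.Theorems.BalabanUVNodesN16ExpGaugeOfSupData
import Summits.QuantumFields.YangMills.Theorems.BalabanUVNodesN16SlotKeyNormalForm
import HarnessLib

/-!
# Route «BalabanUVNodes» (K3⁷ `SpineGivenEndpointR13SepCoPH`, stmt-QuantumFields-20544), DAG node N16 = NE3, in-edge N07 → N16 —
# ★ THE SLOT KEY FROM ITS GAUGE-INVARIANT FORM: `stub_reg910Slot`'s body at `C` ⟸ «covariant plaquette differences of every
# `(C.B₃ε₁)`-class minimiser at an `ε₁`-loose datum are `≤ c·ε₁·L^{−3(k+1)}`» (file 18 of the lineage; over 15∕16∕17 and file 12)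

Cell `pub-ymgap`, width seat `pub-ymgap-dag-n16-w1` (director-ym №197 ∕ HUMAN RULING D-0149), generation 7.  `--kind proof --supports
stmt-QuantumFields-20544 --as helper` (count-neutral).  `bears_on: R4∕N16 · edge N07 → N16`.  THEOREMS ONLY (0 `def`, 0 `sorry`, standard axioms),
BY NAME over file 17 (`expGauge11_of_supData'`, `expGauge11_mono`, `covDiff_plaq_le_of_flux`), file 12 (`N16SlotKeyNormalForm.reg910Slot_of_perSite`),
file 9 (`N16H7LooseOfReg910Slot.two_le_cubeM_slot`) and pub-balaban's `MinimalActionSandwich.IsMinimiser` ∕ `MinimalActionRate.sfClass` ∕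
`MinimalActionRefine.RegularSup` ∕ leaf-06's `MinimalActionDictionary.torusVP`.

THE POINT.  Node N07's debt to node N16 on the (β16) road is dag-n16-e's DischargeTest v6 `stub_reg910Slot F := ∃ G C, RadiiMono 4 G ∧ ⟨(9)_{β₀=1}
interface⟩ ∧ (T9ˢ)(G, C)`; file 12 normalised it to the G-free per-site form (T9♭)(C): at every minimiser `U` over `sfClass (C.B₃ε₁) (k+1)` with an
`ε₁`-loose datum (`ε₁ ≤ C.a₁`) and every site, the per-site (9)_{β₀=1} datum with radii `(t∕L^{k+1}, t∕L^{2(k+1)}, t∕L^{3(k+1)})`, `t < C.B₃·M_k·ε₁`.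
By file 17, such data follow from GAUGE-INVARIANT sup data; here the constants are matched against print's factor:
§1 radius arithmetic (`u = L^{−(k+1)} ≤ 1∕2`, `α = C.B₃ε₁u²`, `γ = cε₁u³`, `c ≤ C.B₃`, `C.B₃ε₁ ≤ 1∕64`): the three radii of `expGauge11_of_supData'`
   sit below `(7∕4)·C.B₃ε₁·(u, u², u³)` — the first-difference radius because its factor in front of `α` is ONE (margin `7∕4 − 1`);
§2 ★★ `perSite_of_supKey`: (T9♭)(C) VERBATIM (file 12's hypothesis `hP`) from the key «`‖covGrad U (U(∂·)) x κ π‖ ≤ c·ε₁∕L^{3(k+1)}` at every such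
   minimiser» with `c ≤ C.B₃`, `C.B₃·C.a₁ ≤ 1∕64`, `L ≥ 2`, and `t = (7∕4)C.B₃ε₁ < 2C.B₃ε₁ ≤ C.B₃M_kε₁` (`two_le_cubeM_slot`); ★★ `slotKeyBody_of_supKey`:
   hence `stub_reg910Slot`'s BODY at `C` (`reg910Slot_of_perSite`);
§3 ★ `slotKeyBody_of_regularSupKey`: the same from «every such minimiser is `RegularSup d L N b (c′ε₁) (k+1)`», `2c′ ≤ C.B₃` (file 17's flux conversion)
   — the loose-`LeafH3sup`∕`RegularSup` currency of this lineage's files 1–6 IMPLIES the slot key, the converse of file 9 §2 (`leafH3sup_loose_of_reg910Slot`)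
   up to the constants' window: the N07 → N16 in-edge can be displayed WITHOUT `G`, cubes or gauges — (8) + a (10)-type sup letter at the (42)-objects.

HONEST FRAMING.  Bookkeeping between displayed hypothesis currencies ([Balaban1985Variational] Thm 1 (8)–(10) p. 279); the keys are HYPOTHESES —
nothing about Bałaban's minimisers is proved, asserted or refuted; `stub_reg910Slot` NOT closed (its content — the (10)-type letter for all
`(C.B₃ε₁)`-class minimisers, uniformly in `k` — stays node N07's); no stub of K3⁷ v5 named or closed; N16 ∕ N07 NOT discharged; count-neutral; counts of
record unmoved (typed 28∕28 · discharged 5∕27, A 5∕28); one finite four-torus at fixed `ε`, Bałaban AS PRINTED — NOT ℝ⁴, NOT infinite volume, NOT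
OS, NOT a mass gap; the YM mass gap (Clay) is NOT proved by any of this — R4 closes the conditional finite-𝕋⁴ rung `BalabanLadder.UV` only.
-/

set_option autoImplicit false

open scoped BigOperators Matrix Matrix.Norms.L2Operator
open NormedSpace

namespace Summit.QuantumFields.YangMills.BalabanUVNodes.N16SlotKeyOfSupData

open Literature.MathematicalPhysics.QuantumFieldTheory.Balaban1983to89
open B7Prop1Explicit B7Prop2Explicit MatrixLog
open T4AveragingDeficitWall hiding Site Plane Plaq Bond
open Summit.QuantumFields.BalabanUV.T4Continuum
open AveragingDeficitLatticeH2Prep (fd)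
open MinimalActionSandwich (IsMinimiser)
open MinimalActionRate (sfClass)
open MinimalActionRefine (RegularSup)
open MinimalActionDictionary (torusVP RadiiMono cubeM)
open MinimalActionHexDictionary (ExpGauge11)
open B11 (Regularity)
open Summit.QuantumFields.YangMills.BalabanUVNodes.N16H7LooseOfReg910Slot (two_le_cubeM_slot)
open Summit.QuantumFields.YangMills.BalabanUVNodes.N16SlotKeyNormalForm (reg910Slot_of_perSite)
open Summit.QuantumFields.YangMills.BalabanUVNodes.N16ExpGaugeOfSupData (expGauge11_of_supData' expGauge11_mono
  covDiff_plaq_le_of_flux)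

noncomputable section

variable {d : ℕ} {n : Type} [Fintype n] [DecidableEq n] [Nonempty n]

/-! ## §1 Radius arithmetic: the three radii of §2 against print's factor `t = (7∕4)·B₃·ε₁ < 2·B₃·ε₁ ≤ M·B₃·ε₁` -/

omit [Fintype n] [DecidableEq n] [Nonempty n] in
/-- Zeroth radius: `2α + 16α² ≤ (7∕4)B₃ε₁·u` for `α = B₃ε₁u²`, `u ≤ 1∕2`, `B₃ε₁ ≤ 1∕64`. [folklore] -/
theorem radius₀_le {u B ε : ℝ} (hu : 0 < u) (hu2 : u ≤ 1 / 2) (hB : 0 < B) (hε : 0 < ε) (hBe : B * ε ≤ 1 / 64) :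
    2 * (B * ε * u ^ 2) + 16 * (B * ε * u ^ 2) ^ 2 ≤ 7 / 4 * (B * ε) * u := by
  have hBε : 0 < B * ε := mul_pos hB hε
  have h1 : u ^ 2 ≤ u * (1 / 2) := by nlinarith
  have h2 : (B * ε * u ^ 2) ^ 2 ≤ (B * ε) * (1 / 64) * (u * (1 / 2)) * (1 / 4) := by
    have e1 : (B * ε * u ^ 2) ^ 2 = (B * ε) * (B * ε) * (u ^ 2) * (u ^ 2) := by ring
    rw [e1]
    have hu4 : u ^ 2 ≤ 1 / 4 := by nlinarith
    gcongr
  nlinarith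

omit [Fintype n] [DecidableEq n] [Nonempty n] in
/-- First radius: `α + γ + 34α² ≤ (7∕4)B₃ε₁·u²` for `α = B₃ε₁u²`, `γ = cε₁u³`, `c ≤ B₃`, `u ≤ 1∕2`, `B₃ε₁ ≤ 1∕64` — the factor in
front of `α` is ONE, so the margin `7∕4 − 1` absorbs the covariant-difference and second-order letters. [folklore] -/
theorem radius₁_le {u B ε c : ℝ} (hu : 0 < u) (hu2 : u ≤ 1 / 2) (hB : 0 < B) (hε : 0 < ε) (hBe : B * ε ≤ 1 / 64)
    (hc : c ≤ B) :
    B * ε * u ^ 2 + c * ε * u ^ 3 + 34 * (B * ε * u ^ 2) ^ 2 ≤ 7 / 4 * (B * ε) * u ^ 2 := by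
  have hBε : 0 < B * ε := mul_pos hB hε
  have h1 : c * ε * u ^ 3 ≤ B * ε * u ^ 2 * (1 / 2) := by
    have e1 : c * ε * u ^ 3 = (c * ε) * u ^ 2 * u := by ring
    rw [e1]; gcongr
  have h2 : (B * ε * u ^ 2) ^ 2 ≤ (B * ε) * u ^ 2 * ((1 / 64) * (1 / 4)) := by
    have e1 : (B * ε * u ^ 2) ^ 2 = (B * ε) * u ^ 2 * ((B * ε) * u ^ 2) := by ring
    rw [e1]
    have hu4 : u ^ 2 ≤ 1 / 4 := by nlinarith
    gcongr
  nlinarith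

omit [Fintype n] [DecidableEq n] [Nonempty n] in
/-- Second radius: `γ + 49α² ≤ (7∕4)B₃ε₁·u³`. [folklore] -/
theorem radius₂_le {u B ε c : ℝ} (hu : 0 < u) (hu2 : u ≤ 1 / 2) (hB : 0 < B) (hε : 0 < ε) (hBe : B * ε ≤ 1 / 64)
    (hc : c ≤ B) :
    c * ε * u ^ 3 + 49 * (B * ε * u ^ 2) ^ 2 ≤ 7 / 4 * (B * ε) * u ^ 3 := by
  have hBε : 0 < B * ε := mul_pos hB hε
  have h1 : c * ε * u ^ 3 ≤ B * ε * u ^ 3 := by gcongr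
  have h2 : (B * ε * u ^ 2) ^ 2 ≤ (B * ε) * u ^ 3 * ((1 / 64) * (1 / 2)) := by
    have e1 : (B * ε * u ^ 2) ^ 2 = (B * ε) * u ^ 3 * ((B * ε) * u) := by ring
    rw [e1]
    gcongr
  nlinarith

/-! ## §2 ★ THE SLOT KEY (T9♭)(C) FROM ITS GAUGE-INVARIANT FORM -/

/-- ★★ **THE G-FREE PER-SITE SLOT KEY (T9♭)(C) FROM THE GAUGE-INVARIANT SUP KEY.**  Suppose that for every run `k+1`, every
`0 < ε₁ ≤ C.a₁`, every loose datum `V ∈ sfClass ε₁ 0` and every minimiser `U` over `sfClass (C.B₃ε₁) (k+1)` at `V`, the covariant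
forward differences of `U`'s PLAQUETTE VARIABLES obey `‖Ad_{U(x,κ)} U(∂p_{x+e_κ;π}) − U(∂p_{x;π})‖ ≤ c·ε₁·L^{−3(k+1)}` with `c ≤ C.B₃`,
and `C.B₃·C.a₁ ≤ 1∕64`, `L ≥ 2`.  Then the per-site (9)_{β₀=1} data of file 12's (T9♭) hold at every site with the factor
`t = (7∕4)·C.B₃·ε₁ < C.B₃·M_k·ε₁` (`M_k ≥ 2`, file 9 `two_le_cubeM_slot`): (8) (class membership) + this (10)-type letter ⟹ (9).
NOTHING about minimisers is proved here — the hypothesis is node N07's content in gauge-invariant currency. [folklore] -/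
theorem perSite_of_supKey {L N : ℕ} (hL : 2 ≤ L) (C : B11Thm1.Consts) {c : ℝ} (hc0 : 0 ≤ c) (hcB : c ≤ C.B₃)
    (hBa : C.B₃ * C.a₁ ≤ 1 / 64)
    (hK : ∀ (k : ℕ) (ε₁ : ℝ), 0 < ε₁ → ε₁ ≤ C.a₁ → ∀ (V U : Site d → Fin d → (Matrix n n ℂ)ˣ), V ∈ sfClass d L N ε₁ 0 →
      IsMinimiser d (sfClass d L N (C.B₃ * ε₁)) L N (k + 1) V U →
        ∀ (x : Site d) (κ : Fin d) (π : T4AveragingDeficitWall.Plane d),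
          ‖covGrad U (fun q => ((fhol U q : (Matrix n n ℂ)ˣ) : Matrix n n ℂ)) x κ π‖ ≤ c * ε₁ / ((L : ℝ) ^ (k + 1)) ^ 3) :
    ∀ (k : ℕ) (ε₁ : ℝ), 0 < ε₁ → ε₁ ≤ C.a₁ → ∀ (V U : Site d → Fin d → (Matrix n n ℂ)ˣ), V ∈ sfClass d L N ε₁ 0 →
      IsMinimiser d (sfClass d L N (C.B₃ * ε₁)) L N (k + 1) V U →
        ∀ x : Site d, ∃ t : ℝ, 0 ≤ t ∧ t < C.B₃ * cubeM L (k + 1) (L ^ (k + 1) - 1 + L ^ (k + 1) + 2) * ε₁ ∧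
          ∃ (u : Site d → (Matrix n n ℂ)ˣ) (a : Site d → Fin d → Matrix n n ℂ),
            (∀ z, u z ∈ unitaryUnits (Matrix n n ℂ)) ∧
            (∀ (y : Site d) (τ : Fin d), l1 (y - x) ≤ 2 →
              ((gaugeAct u U y τ : (Matrix n n ℂ)ˣ) : Matrix n n ℂ) = exp (a y τ)) ∧
            (∀ (y : Site d) (τ : Fin d), l1 (y - x) ≤ 2 → ‖a y τ‖ ≤ t / (L : ℝ) ^ (k + 1)) ∧
            (∀ (y : Site d) (τ i : Fin d), l1 (y - x) ≤ 1 → ‖fd i (fun z => a z τ) y‖ ≤ t / ((L : ℝ) ^ (k + 1)) ^ 2) ∧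
            (∀ (τ i l : Fin d), ‖fd i (fd l (fun z => a z τ)) x‖ ≤ t / ((L : ℝ) ^ (k + 1)) ^ 3) := by
  intro k ε₁ hε hεa V U hV hU x
  obtain ⟨hUu, -, hUs⟩ := hU.mem.1
  have hB := C.B₃_pos
  -- the scale `s = L^{k+1} ≥ 2`, `u = 1/s ≤ 1/2`
  set s : ℝ := (L : ℝ) ^ (k + 1) with hs
  have hL2 : (2 : ℝ) ≤ L := by exact_mod_cast hL
  have hs2 : 2 ≤ s := by
    rw [hs]
    calc (2 : ℝ) = 2 ^ 1 := by norm_num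
      _ ≤ (L : ℝ) ^ 1 := by gcongr
      _ ≤ (L : ℝ) ^ (k + 1) := pow_le_pow_right₀ (by linarith) (by omega)
  have hs0 : 0 < s := by linarith
  set u : ℝ := s⁻¹ with hu
  have hu0 : 0 < u := inv_pos.mpr hs0
  have hu2 : u ≤ 1 / 2 := by rw [hu, one_div]; exact inv_anti₀ (by norm_num) hs2
  have hBe : C.B₃ * ε₁ ≤ 1 / 64 := (mul_le_mul_of_nonneg_left hεa hB.le).trans hBa
  -- the two letters in `u`-form
  have hα : C.B₃ * ε₁ / s ^ 2 = C.B₃ * ε₁ * u ^ 2 := by rw [hu, inv_pow, div_eq_mul_inv]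
  have hγ : c * ε₁ / s ^ 3 = c * ε₁ * u ^ 3 := by rw [hu, inv_pow, div_eq_mul_inv]
  have hα4 : C.B₃ * ε₁ * u ^ 2 ≤ 1 / 4 := by
    have : u ^ 2 ≤ 1 := by nlinarith
    nlinarith [mul_pos hB hε]
  rw [hα] at hUs
  have hKU : ∀ (y : Site d) (κ : Fin d) (π : T4AveragingDeficitWall.Plane d),
      ‖covGrad U (fun q => ((fhol U q : (Matrix n n ℂ)ˣ) : Matrix n n ℂ)) y κ π‖ ≤ c * ε₁ * u ^ 3 := by
    intro y κ π; rw [← hγ]; exact hK k ε₁ hε hεa V U hV hU y κ π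
  have hE := expGauge11_of_supData' hUu (by positivity) hα4 (by positivity) hUs hKU x
  -- the factor `t = (7/4)·B₃·ε₁`
  refine ⟨7 / 4 * (C.B₃ * ε₁), by positivity, ?_, ?_⟩
  · have hM := two_le_cubeM_slot (L := L) (by omega) (k + 1)
    have hBε : 0 < C.B₃ * ε₁ := mul_pos hB hε
    calc 7 / 4 * (C.B₃ * ε₁) < 2 * (C.B₃ * ε₁) := by nlinarith
      _ ≤ C.B₃ * cubeM L (k + 1) (L ^ (k + 1) - 1 + L ^ (k + 1) + 2) * ε₁ := by nlinarith
  · have r0 := radius₀_le hu0 hu2 hB hε hBe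
    have r1 := radius₁_le hu0 hu2 hB hε hBe hcB
    have r2 := radius₂_le hu0 hu2 hB hε hBe hcB
    have e1 : 7 / 4 * (C.B₃ * ε₁) / (L : ℝ) ^ (k + 1) = 7 / 4 * (C.B₃ * ε₁) * u := by rw [← hs, hu, div_eq_mul_inv]
    have e2 : 7 / 4 * (C.B₃ * ε₁) / ((L : ℝ) ^ (k + 1)) ^ 2 = 7 / 4 * (C.B₃ * ε₁) * u ^ 2 := by
      rw [← hs, hu, inv_pow, div_eq_mul_inv]
    have e3 : 7 / 4 * (C.B₃ * ε₁) / ((L : ℝ) ^ (k + 1)) ^ 3 = 7 / 4 * (C.B₃ * ε₁) * u ^ 3 := by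
      rw [← hs, hu, inv_pow, div_eq_mul_inv]
    obtain ⟨w, a, hw, he, h0, h1, h2⟩ := expGauge11_mono hE r0 r1 r2
    refine ⟨w, a, hw, he, ?_, ?_, ?_⟩
    · intro y τ hy; rw [e1]; exact h0 y τ hy
    · intro y τ i hy; rw [e2]; exact h1 y τ i hy
    · intro τ i l; rw [e3]; exact h2 τ i l

/-- ★★ **THE SLOT KEY's BODY FROM ITS GAUGE-INVARIANT FORM**: under the hypotheses of `perSite_of_supKey`, the body of dag-n16-e's
DischargeTest v6 `stub_reg910Slot` AT THE CONSTANTS `C` — «some local-gauge shape `G`, monotone in its radii and meeting the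
(9)_{β₀=1} interface, satisfies (T9ˢ)(G, C)» — holds (file 12 `reg910Slot_of_perSite` BY NAME).  So node N07's debt to node N16 on the
(β16) road may be DISPLAYED in pure (8)+(10) currency: «covariant plaquette differences of every `(C.B₃ε₁)`-class minimiser at an
`ε₁`-loose datum are `≤ c·ε₁·L^{−3(k+1)}`, `c ≤ C.B₃`» (plus the window `C.B₃·C.a₁ ≤ 1∕64`).  The hypothesis is NOT proved here.
[cite: Balaban1985Variational, Thm 1 (8)–(10) p.279] -/
theorem slotKeyBody_of_supKey {L N : ℕ} (hL : 2 ≤ L) (C : B11Thm1.Consts) {c : ℝ} (hc0 : 0 ≤ c) (hcB : c ≤ C.B₃)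
    (hBa : C.B₃ * C.a₁ ≤ 1 / 64)
    (hK : ∀ (k : ℕ) (ε₁ : ℝ), 0 < ε₁ → ε₁ ≤ C.a₁ → ∀ (V U : Site d → Fin d → (Matrix n n ℂ)ˣ), V ∈ sfClass d L N ε₁ 0 →
      IsMinimiser d (sfClass d L N (C.B₃ * ε₁)) L N (k + 1) V U →
        ∀ (x : Site d) (κ : Fin d) (π : T4AveragingDeficitWall.Plane d),
          ‖covGrad U (fun q => ((fhol U q : (Matrix n n ℂ)ˣ) : Matrix n n ℂ)) x κ π‖ ≤ c * ε₁ / ((L : ℝ) ^ (k + 1)) ^ 3) :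
    ∃ G : (Site d → Fin d → (Matrix n n ℂ)ˣ) → Site d → ℕ → ℝ → ℝ → ℝ → Prop,
      RadiiMono d G ∧
      (∀ (U : Site d → Fin d → (Matrix n n ℂ)ˣ) (x : Site d) (K : ℕ) (α₀ α₁ α₂ : ℝ), 2 ≤ K → G U x K α₀ α₁ α₂ →
        ∃ (u : Site d → (Matrix n n ℂ)ˣ) (a : Site d → Fin d → Matrix n n ℂ),
          (∀ z, u z ∈ unitaryUnits (Matrix n n ℂ)) ∧
          (∀ (y : Site d) (τ : Fin d), l1 (y - x) ≤ 2 → ((gaugeAct u U y τ : (Matrix n n ℂ)ˣ) : Matrix n n ℂ) = exp (a y τ)) ∧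
          (∀ (y : Site d) (τ : Fin d), l1 (y - x) ≤ 2 → ‖a y τ‖ ≤ α₀) ∧
          (∀ (y : Site d) (τ i : Fin d), l1 (y - x) ≤ 1 → ‖fd i (fun z => a z τ) y‖ ≤ α₁) ∧
          (∀ (τ i l : Fin d), ‖fd i (fd l (fun z => a z τ)) x‖ ≤ α₂)) ∧
      (∀ (k : ℕ) (ε₁ : ℝ), 0 < ε₁ → ε₁ ≤ C.a₁ → ∀ (V U : Site d → Fin d → (Matrix n n ℂ)ˣ), V ∈ sfClass d L N ε₁ 0 →
        IsMinimiser d (sfClass d L N (C.B₃ * ε₁)) L N (k + 1) V U →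
          ∀ x : Site d, Regularity (torusVP d L N G (k + 1)) C.B₃ C.B₄ ε₁ U (x, L ^ (k + 1) - 1 + L ^ (k + 1) + 2)) :=
  reg910Slot_of_perSite (by omega) C (perSite_of_supKey hL C hc0 hcB hBa hK)

/-! ## §3 The same from the `RegularSup` letters (flux-gradient currency of pub-balaban's NE3 leaves) -/

/-- ★ **THE SLOT KEY's BODY FROM `RegularSup`-TYPE REGULARITY OF THE MINIMISERS**: if every `(C.B₃ε₁)`-class minimiser at an
`ε₁`-loose datum is `RegularSup d L N b (c′ε₁) (k+1)` (any plaquette letter `b`; flux-gradient letter `c′ε₁` with `2c′ ≤ C.B₃`) and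
`C.B₃·C.a₁ ≤ 1∕64`, `L ≥ 2`, then the slot key's body holds at `C` — i.e. the loose `LeafH3sup`-currency of the lineage's files 1–6
(here with the class radius `C.B₃ε₁` and data radius `ε₁`) IMPLIES the slot key; the converse is file 9 §2.  The hypothesis is node
N07's content ([Balaban1985Variational] Thm 1 (8)+(10) at the (42)-objects), NOT proved here. [cite: Balaban1985Variational, Thm 1 (8)–(10) p.279] -/
theorem slotKeyBody_of_regularSupKey {L N : ℕ} (hL : 2 ≤ L) (C : B11Thm1.Consts) {b c' : ℝ} (hc0 : 0 ≤ c')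
    (hcB : 2 * c' ≤ C.B₃) (hBa : C.B₃ * C.a₁ ≤ 1 / 64)
    (hR : ∀ (k : ℕ) (ε₁ : ℝ), 0 < ε₁ → ε₁ ≤ C.a₁ → ∀ (V U : Site d → Fin d → (Matrix n n ℂ)ˣ), V ∈ sfClass d L N ε₁ 0 →
      IsMinimiser d (sfClass d L N (C.B₃ * ε₁)) L N (k + 1) V U → RegularSup d L N b (c' * ε₁) (k + 1) U) :
    ∃ G : (Site d → Fin d → (Matrix n n ℂ)ˣ) → Site d → ℕ → ℝ → ℝ → ℝ → Prop,
      RadiiMono d G ∧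
      (∀ (U : Site d → Fin d → (Matrix n n ℂ)ˣ) (x : Site d) (K : ℕ) (α₀ α₁ α₂ : ℝ), 2 ≤ K → G U x K α₀ α₁ α₂ →
        ∃ (u : Site d → (Matrix n n ℂ)ˣ) (a : Site d → Fin d → Matrix n n ℂ),
          (∀ z, u z ∈ unitaryUnits (Matrix n n ℂ)) ∧
          (∀ (y : Site d) (τ : Fin d), l1 (y - x) ≤ 2 → ((gaugeAct u U y τ : (Matrix n n ℂ)ˣ) : Matrix n n ℂ) = exp (a y τ)) ∧
          (∀ (y : Site d) (τ : Fin d), l1 (y - x) ≤ 2 → ‖a y τ‖ ≤ α₀) ∧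
          (∀ (y : Site d) (τ i : Fin d), l1 (y - x) ≤ 1 → ‖fd i (fun z => a z τ) y‖ ≤ α₁) ∧
          (∀ (τ i l : Fin d), ‖fd i (fd l (fun z => a z τ)) x‖ ≤ α₂)) ∧
      (∀ (k : ℕ) (ε₁ : ℝ), 0 < ε₁ → ε₁ ≤ C.a₁ → ∀ (V U : Site d → Fin d → (Matrix n n ℂ)ˣ), V ∈ sfClass d L N ε₁ 0 →
        IsMinimiser d (sfClass d L N (C.B₃ * ε₁)) L N (k + 1) V U →
          ∀ x : Site d, Regularity (torusVP d L N G (k + 1)) C.B₃ C.B₄ ε₁ U (x, L ^ (k + 1) - 1 + L ^ (k + 1) + 2)) := by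
  refine slotKeyBody_of_supKey hL C (c := 2 * c') (by positivity) hcB hBa ?_
  intro k ε₁ hε hεa V U hV hU x κ π
  obtain ⟨hUu, -, hUs⟩ := hU.mem.1
  have hB := C.B₃_pos
  have hs1 : (1 : ℝ) ≤ ((L : ℝ) ^ (k + 1)) ^ 2 := one_le_pow₀ (one_le_pow₀ (by exact_mod_cast (by omega : 1 ≤ L)))
  have hα4 : C.B₃ * ε₁ / ((L : ℝ) ^ (k + 1)) ^ 2 ≤ 1 / 4 := by
    have hBe : C.B₃ * ε₁ ≤ 1 / 64 := (mul_le_mul_of_nonneg_left hεa hB.le).trans hBa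
    exact (div_le_self (by positivity) hs1).trans (by linarith)
  have hgrad := (hR k ε₁ hε hεa V U hV hU).grad
  have h := covDiff_plaq_le_of_flux hUu hα4 hUs hgrad x κ π
  rw [show 2 * c' * ε₁ / ((L : ℝ) ^ (k + 1)) ^ 3 = 2 * (c' * ε₁ / ((L : ℝ) ^ (k + 1)) ^ 3) by ring]
  exact h

end

end Summit.QuantumFields.YangMills.BalabanUVNodes.N16SlotKeyOfSupData
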